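/-
Copyright (c) 2026 the pub-hodgecm-mathlib formalisation cell (harness21).  Prover seat hodgecm-mathlib-K2E4-p13 (g2), Track B «K2-LIT» ∕ h413, ‹S› ROAD J — (α) «EP-EXPOSED TWIN EXPORT»
of ★ J1′ p856014 (K2E4-p08 (g2)): the S1 dress with the value of the transfer at the centre, for a BOUND Euler–Poincaré datum `(f₂, r)`.  2026-09-04.
-/
import Summits.HodgeConjecture.HodgeConjecture.Theorems.K2E3SingularTransferDressValueAtCentre      -- ★ J1′ p856014 (K2E4-p08): the export with `∃ r`; brings ★ J1, ★ A-p16 S1 dress, rungs 1–5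
import Literature.NumberTheory.Rogawski1990.LocalTransferCompactSideJunctionValueEPCM             -- ★ (this seat) rung 3♭: the compact-side junction with value for a BOUND EP datum
import HarnessLib

/-!
# (α) J1′♭ — the S1 dress WITH THE VALUE AT THE CENTRE for a BOUND Euler–Poincaré datum `(f₂, r)` (road J of ‹S›, crux h413)

Cell `pub/hodgecm-mathlib`, Track B «K2-LIT», crux H413 = `stmt-HodgeConjecture-24833`; ‹S› = `sig_K2E3SingularTransferSigned` (E3-owned), ROAD J.  Dealt BY NAME by K2E4-plan (g2)
2026-09-04T00:23:09Z, deal (1): «(α) EP-EXPOSED TWIN EXPORT `Theorems/K2E3SingularTransferDressValueAtCentreOfEP.lean` — statement = ★ p856014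
`…K2E3SingularTransferDressValueAtCentre.exists_nhds_local_transfer_and_apply_centre` with the existential `r` REPLACED by a universally bound EP datum `(f₂, r)` carrying ★ J2♯
`rankOneEulerPoincareNonsplit_withCentralValue`'s conclusion fields VERBATIM, so that ‹J3› can be typed against a NAMED `(f₂, r)`»; consumed by K2E4-p14 (g2)'s (β) ROAD-J ASSEMBLER
`Theorems/K2E3SingularTransferLocalGermValueOfRoadJ.lean`.  THEOREMS ONLY; lane `--supports stmt-HodgeConjecture-24833 --as helper`.

THE STATEMENT.  ★ p856014's ∀-prefix VERBATIM (`stub_N6nsS1pkg`'s prefix, then the closed orbit of the dock point `ε`), then the BOUND EP DATUM: Borel structures on `U(Φ₂)_v` and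
its orbit spaces, a family `m₂` canonical for the regular classes and `ν₂ := (pr₁)_* ν_H`, `f₂ ∈ C_c^∞(U(Φ₂)_v)` with orbital integrals `1` on the regular elliptic and `0` on the
regular split classes (w.r.t. `m₂`) and ONE scalar value `f₂(b·1) = −r` (`r : ℝ`, no sign asked) — EXACTLY the conclusion fields of ★ J2♯ for `(ν₂, m₂)` — and the conclusion of ★
p856014 WITHOUT `∃ r` ∕ `0 < r`: the framed second class `ε′` (`ε′·P′ = P′·(a·1₂ ⊕ᶠ u)`, matched with `ε_H`), `stub_N6nsS1`'s body near `ε_H`, and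
  **`φ^H(ε_H) = Δ‴_v(ε_H, ε) · Φ(ε, φ; ν_G ∕ θ_*ν_H) + Δ‴_v(ε_H, ε′) · (∫_{G′_v} φ(y ε′ y⁻¹) dν_G(y)) · (−r)`** for THIS `r`.
ROAD (dealer's fork, decided by reading): ★ rung 3 p855836 CONSUMES J2♯ internally (`obtain ⟨f, …, r₀, hr₀, hfval⟩ := rankOneEulerPoincareNonsplit_withCentralValue …`), rung 5 does
not touch it ⇒ TWO files: ★ rung 3♭ `exists_nhds_finsum_side_eq_stableOrbitalIntegralRel_and_apply_centre_of_compact_dock_of_EP` (Literature, this seat: rung 3's proof with the EP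
datum bound; the torus-measure provider still from ★ `exists_isCanonical_cmDatum_local_two`) and THIS file = ★ p856014's proof token for token with step (4) replaced by rung 3♭.
With J2♯'s own witness `(f_EP, r₀)` this theorem gives back ★ p856014 (modulo `0 < r₀`, which J2♯ supplies).

* **`exists_nhds_local_transfer_and_apply_centre_of_EP`**.

HONEST LABEL: HC_CM is proved only modulo the 7 printed citations (2 remaining named inputs: hLiu418 = `stmt-HodgeConjecture-24832`, h413 = `stmt-HodgeConjecture-24833`) until
rung 0 closes; this file is a `--supports` helper (assembly over ★ files), it pays no socket by itself.

## References
* [Rogawski1990] J. D. Rogawski, *Automorphic Representations of Unitary Groups in Three Variables*, Ann. of Math. Stud. 123 (1990): §8.2 Prop. 8.2.1 (a)(d) pp. 112–122; §8.1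
  Prop. 8.1.3 pp. 110–111; §12.6 p. 174 (`Γ₁ = (−1)^q d(St)⁻¹`); §4.3 (4.3.1) p. 43.
* [Kottwitz1988] R. E. Kottwitz, *Tamagawa numbers*, Ann. of Math. 127 (1988), §2 Theorem 2 (the Euler–Poincaré function).
* [LanglandsShelstad1990Descent] R. P. Langlands, D. Shelstad, *Descent for transfer factors*, The Grothendieck Festschrift II (1990), Thm. 2.3.A, §2.4.
-/

set_option autoImplicit false
set_option linter.dupNamespace false

noncomputable section

open Set Filter Topology MeasureTheory MeasureTheory.Measure NumberField IsDedekindDomain Matrix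
open Literature.NumberTheory.Automorphic Literature.NumberTheory.Automorphic.UnitaryGroup Literature.NumberTheory.GaloisRepresentations Literature.MeasureTheory.Group
open Literature.NumberTheory.Rogawski1990
open Literature.AlgebraicGeometry.ShimuraVarieties (unitaryGroup)
open Summit.HodgeConjecture.HodgeConjecture.Cruxes.H413.K2E3SingularDescentValueAtCentre
open scoped MatrixGroups

namespace Summit.HodgeConjecture.HodgeConjecture.Cruxes.H413.K2E3SingularTransferDressValueAtCentreOfEP

open scoped Classical in
/-- **(α) J1′♭ — THE S1 DRESS WITH THE VALUE OF THE TRANSFER AT THE CENTRE, FOR A BOUND EULER–POINCARÉ DATUM `(f₂, r)`.**  See the module docstring: ★ p856014's prefix, the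
closed orbit of the dock point `ε`, the EP datum `(m₂, f₂, r)` with ★ J2♯'s conclusion fields as hypotheses, then `∃ ε′`, the frame relation and matching of `ε′`, `stub_N6nsS1`'s body,
and `φ^H(ε_H) = Δ‴(ε_H,ε)·Φ(ε, φ; ν_G∕θ_*ν_H) + Δ‴(ε_H,ε′)·(∫ φ(yε′y⁻¹) dν_G)·(−r)`.
[cite: Rogawski1990, §8.2 Prop. 8.2.1 (a)(d) pp. 112–122; §8.1 Prop. 8.1.3 pp. 110–111; §12.6 p. 174] [cite: LanglandsShelstad1990Descent, Thm. 2.3.A, §2.4] [cite: Kottwitz1988, §2 Theorem 2] -/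
theorem exists_nhds_local_transfer_and_apply_centre_of_EP :
    ∀ (L : Type) [Field L] [NumberField L] [IsCMField L] (H' : Matrix (Fin 3) (Fin 3) L) (μ : HeckeCharacter L)
      [∀ v : HeightOneSpectrum (𝓞 ↥(maximalRealSubfield L)),
        MeasurableSpace ((UnitaryGroup.cmDatum L 2 (Matrix.of fun i j : Fin 2 => if i.val + j.val + 1 = 2 then (1 : L) else 0)).Local v ×
          (UnitaryGroup.cmDatum L 1 (Matrix.of fun i j : Fin 1 => if i.val + j.val + 1 = 1 then (1 : L) else 0)).Local v)]
      [∀ v : HeightOneSpectrum (𝓞 ↥(maximalRealSubfield L)),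
        BorelSpace ((UnitaryGroup.cmDatum L 2 (Matrix.of fun i j : Fin 2 => if i.val + j.val + 1 = 2 then (1 : L) else 0)).Local v ×
          (UnitaryGroup.cmDatum L 1 (Matrix.of fun i j : Fin 1 => if i.val + j.val + 1 = 1 then (1 : L) else 0)).Local v)]
      [∀ v : HeightOneSpectrum (𝓞 ↥(maximalRealSubfield L)), MeasurableSpace ((UnitaryGroup.cmDatum L 3 H').Local v)]
      [∀ v : HeightOneSpectrum (𝓞 ↥(maximalRealSubfield L)), BorelSpace ((UnitaryGroup.cmDatum L 3 H').Local v)]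
      (νH : ∀ v : HeightOneSpectrum (𝓞 ↥(maximalRealSubfield L)),
        Measure ((UnitaryGroup.cmDatum L 2 (Matrix.of fun i j : Fin 2 => if i.val + j.val + 1 = 2 then (1 : L) else 0)).Local v ×
          (UnitaryGroup.cmDatum L 1 (Matrix.of fun i j : Fin 1 => if i.val + j.val + 1 = 1 then (1 : L) else 0)).Local v))
      (νG : ∀ v : HeightOneSpectrum (𝓞 ↥(maximalRealSubfield L)), Measure ((UnitaryGroup.cmDatum L 3 H').Local v))
      [∀ v, (νH v).IsHaarMeasure] [∀ v, (νH v).IsMulRightInvariant] [∀ v, (νG v).IsHaarMeasure] [∀ v, (νG v).IsMulRightInvariant],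
      μ.IsUnitary →
      (∀ x : ideleGroup ↥(maximalRealSubfield L), μ (AdeleRing.ideleBaseChange (↥(maximalRealSubfield L)) L x) = quadraticHeckeCharCM L x) →
      (H'.map (cmConjRingHom L)).transpose = H' →
      (∀ x : Fin 3 → L, Literature.AlgebraicGeometry.ShimuraVarieties.hermForm (cmConjRingHom L) H' x x = 0 → x = 0) →
      ∀ (v : HeightOneSpectrum (𝓞 ↥(maximalRealSubfield L))), Subsingleton (UnitaryGroup.PlacesOver L v) →
      ∀ [_iH : ∀ a : ((UnitaryGroup.cmDatum L 2 (Matrix.of fun i j : Fin 2 => if i.val + j.val + 1 = 2 then (1 : L) else 0)).Local v × (UnitaryGroup.cmDatum L 1 (Matrix.of fun i j : Fin 1 => if i.val + j.val + 1 = 1 then (1 : L) else 0)).Local v),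
          MeasurableSpace (((UnitaryGroup.cmDatum L 2 (Matrix.of fun i j : Fin 2 => if i.val + j.val + 1 = 2 then (1 : L) else 0)).Local v × (UnitaryGroup.cmDatum L 1 (Matrix.of fun i j : Fin 1 => if i.val + j.val + 1 = 1 then (1 : L) else 0)).Local v) ⧸
            Subgroup.centralizer ({a} : Set ((UnitaryGroup.cmDatum L 2 (Matrix.of fun i j : Fin 2 => if i.val + j.val + 1 = 2 then (1 : L) else 0)).Local v × (UnitaryGroup.cmDatum L 1 (Matrix.of fun i j : Fin 1 => if i.val + j.val + 1 = 1 then (1 : L) else 0)).Local v)))]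
        [_bH : ∀ a : ((UnitaryGroup.cmDatum L 2 (Matrix.of fun i j : Fin 2 => if i.val + j.val + 1 = 2 then (1 : L) else 0)).Local v × (UnitaryGroup.cmDatum L 1 (Matrix.of fun i j : Fin 1 => if i.val + j.val + 1 = 1 then (1 : L) else 0)).Local v),
          BorelSpace (((UnitaryGroup.cmDatum L 2 (Matrix.of fun i j : Fin 2 => if i.val + j.val + 1 = 2 then (1 : L) else 0)).Local v × (UnitaryGroup.cmDatum L 1 (Matrix.of fun i j : Fin 1 => if i.val + j.val + 1 = 1 then (1 : L) else 0)).Local v) ⧸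
            Subgroup.centralizer ({a} : Set ((UnitaryGroup.cmDatum L 2 (Matrix.of fun i j : Fin 2 => if i.val + j.val + 1 = 2 then (1 : L) else 0)).Local v × (UnitaryGroup.cmDatum L 1 (Matrix.of fun i j : Fin 1 => if i.val + j.val + 1 = 1 then (1 : L) else 0)).Local v)))]
        [_iG : ∀ γ : ((UnitaryGroup.cmDatum L 3 H').Local v), MeasurableSpace (((UnitaryGroup.cmDatum L 3 H').Local v) ⧸ Subgroup.centralizer ({γ} : Set ((UnitaryGroup.cmDatum L 3 H').Local v)))]
        [_bG : ∀ γ : ((UnitaryGroup.cmDatum L 3 H').Local v), BorelSpace (((UnitaryGroup.cmDatum L 3 H').Local v) ⧸ Subgroup.centralizer ({γ} : Set ((UnitaryGroup.cmDatum L 3 H').Local v)))]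
        (mH : OrbitalMeasureFamily ((UnitaryGroup.cmDatum L 2 (Matrix.of fun i j : Fin 2 => if i.val + j.val + 1 = 2 then (1 : L) else 0)).Local v × (UnitaryGroup.cmDatum L 1 (Matrix.of fun i j : Fin 1 => if i.val + j.val + 1 = 1 then (1 : L) else 0)).Local v))
        (mG : OrbitalMeasureFamily ((UnitaryGroup.cmDatum L 3 H').Local v)),
      mH.IsCanonical (IsLocalGRegular L v) (νH v) → mG.IsCanonical (fun γ => IsRegularElt (γ.val : GL (Fin 3) (UnitaryGroup.LocalRing L v))) (νG v) →
      ∀ (φ : ((UnitaryGroup.cmDatum L 3 H').Local v) → ℂ), IsLocSmooth φ →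
      ∀ (εH : ((UnitaryGroup.cmDatum L 2 (Matrix.of fun i j : Fin 2 => if i.val + j.val + 1 = 2 then (1 : L) else 0)).Local v × (UnitaryGroup.cmDatum L 1 (Matrix.of fun i j : Fin 1 => if i.val + j.val + 1 = 1 then (1 : L) else 0)).Local v)) (a : (UnitaryGroup.LocalRing L v)),
        (εH.1.val.val : Matrix (Fin 2) (Fin 2) (UnitaryGroup.LocalRing L v)) = a • (1 : Matrix (Fin 2) (Fin 2) (UnitaryGroup.LocalRing L v)) →
        (εH.2.val.val : Matrix (Fin 1) (Fin 1) (UnitaryGroup.LocalRing L v)) 0 0 ≠ a →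
        -- the central dock (★ `exists_centralDock_of_fst_eq_smul_one`)
        ∀ (ε : ((UnitaryGroup.cmDatum L 3 H').Local v)) (y : GL (Fin 3) (UnitaryGroup.LocalRing L v)) (θ : ((UnitaryGroup.cmDatum L 2 (Matrix.of fun i j : Fin 2 => if i.val + j.val + 1 = 2 then (1 : L) else 0)).Local v × (UnitaryGroup.cmDatum L 1 (Matrix.of fun i j : Fin 1 => if i.val + j.val + 1 = 1 then (1 : L) else 0)).Local v) ≃ₜ* ↥(Subgroup.centralizer ({ε} : Set ((UnitaryGroup.cmDatum L 3 H').Local v)))),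
        (θ εH).1 = ε →
        (∀ z : ((UnitaryGroup.cmDatum L 2 (Matrix.of fun i j : Fin 2 => if i.val + j.val + 1 = 2 then (1 : L) else 0)).Local v × (UnitaryGroup.cmDatum L 1 (Matrix.of fun i j : Fin 1 => if i.val + j.val + 1 = 1 then (1 : L) else 0)).Local v), (((θ z).1).val : GL (Fin 3) (UnitaryGroup.LocalRing L v)) = y * ((endoEmbLocal L v z).val : GL (Fin 3) (UnitaryGroup.LocalRing L v)) * y⁻¹) →
        -- the bad frame on the dock (★ `exists_badFrame_dock`)
        ∀ (W : GL (Fin 3) (UnitaryGroup.LocalRing L v)), W.val = !![(1 : UnitaryGroup.LocalRing L v), 0, 0; 0, 0, 1; 0, 1, 0] →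
        ∀ (G₁ G₁' : Matrix (Fin 2) (Fin 2) (UnitaryGroup.LocalRing L v)) (G₂ G₂' : Matrix (Fin 1) (Fin 1) (UnitaryGroup.LocalRing L v)) (P' : GL (Fin (2 + 1)) (UnitaryGroup.LocalRing L v)),
        twistGram (UnitaryGroup.conjLocal L (IsCMField.complexConj L) v) ((UnitaryGroup.adelicForm L 3 H').map (UnitaryGroup.adeleToLocal L v)) (y * W).val = UnitaryGroup.finSum 2 1 G₁ G₂ →
        twistGram (UnitaryGroup.conjLocal L (IsCMField.complexConj L) v) ((UnitaryGroup.adelicForm L 3 H').map (UnitaryGroup.adeleToLocal L v)) P'.val = UnitaryGroup.finSum 2 1 G₁' G₂' →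
        (¬ ∃ z : UnitaryGroup.LocalRing L v, IsUnit z ∧ G₁'.det = G₁.det * (UnitaryGroup.conjLocal L (IsCMField.complexConj L) v z * z)) →
        -- the orbit of the dock point `ε` is closed (`(ε − a)(ε − u) = 0` with `a − u` a unit: ★ `isClosed_conjClass_local_of_mul_sub_smul_eq_zero`)
        IsClosed {g : ((UnitaryGroup.cmDatum L 3 H').Local v) | ∃ x : ((UnitaryGroup.cmDatum L 3 H').Local v), x * ε * x⁻¹ = g} →
        -- an Euler–Poincaré datum `(ν₂, m₂, f₂, r)` on `U(Φ₂)_v` (★ J2♯ `rankOneEulerPoincareNonsplit_withCentralValue`'s inputs and conclusion fields, BOUND): Borel structures on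
        -- `U(Φ₂)_v` and its orbit spaces, a Haar measure `ν₂ = (pr₁)_* ν_H`, a family `m₂` canonical for the regular classes and `ν₂`, `f₂ ∈ C_c^∞(U(Φ₂)_v)` with orbital integrals
        -- `1 ∕ 0` on the regular elliptic ∕ split classes (w.r.t. `m₂`), and the scalar value `f₂(b·1) = −r`
        ∀ [_iU₂ : MeasurableSpace ((UnitaryGroup.cmDatum L 2 (Matrix.of fun i j : Fin 2 => if i.val + j.val + 1 = 2 then (1 : L) else 0)).Local v)] [_bU₂ : BorelSpace ((UnitaryGroup.cmDatum L 2 (Matrix.of fun i j : Fin 2 => if i.val + j.val + 1 = 2 then (1 : L) else 0)).Local v)]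
          [_iZ₂ : ∀ γ : ((UnitaryGroup.cmDatum L 2 (Matrix.of fun i j : Fin 2 => if i.val + j.val + 1 = 2 then (1 : L) else 0)).Local v), MeasurableSpace (((UnitaryGroup.cmDatum L 2 (Matrix.of fun i j : Fin 2 => if i.val + j.val + 1 = 2 then (1 : L) else 0)).Local v) ⧸ Subgroup.centralizer ({γ} : Set ((UnitaryGroup.cmDatum L 2 (Matrix.of fun i j : Fin 2 => if i.val + j.val + 1 = 2 then (1 : L) else 0)).Local v)))]
          [_bZ₂ : ∀ γ : ((UnitaryGroup.cmDatum L 2 (Matrix.of fun i j : Fin 2 => if i.val + j.val + 1 = 2 then (1 : L) else 0)).Local v), BorelSpace (((UnitaryGroup.cmDatum L 2 (Matrix.of fun i j : Fin 2 => if i.val + j.val + 1 = 2 then (1 : L) else 0)).Local v) ⧸ Subgroup.centralizer ({γ} : Set ((UnitaryGroup.cmDatum L 2 (Matrix.of fun i j : Fin 2 => if i.val + j.val + 1 = 2 then (1 : L) else 0)).Local v)))]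
          (ν₂ : Measure ((UnitaryGroup.cmDatum L 2 (Matrix.of fun i j : Fin 2 => if i.val + j.val + 1 = 2 then (1 : L) else 0)).Local v)) [ν₂.IsHaarMeasure] [ν₂.IsMulRightInvariant]
          (m₂ : OrbitalMeasureFamily ((UnitaryGroup.cmDatum L 2 (Matrix.of fun i j : Fin 2 => if i.val + j.val + 1 = 2 then (1 : L) else 0)).Local v)),
        Measure.map (Prod.fst : (((UnitaryGroup.cmDatum L 2 (Matrix.of fun i j : Fin 2 => if i.val + j.val + 1 = 2 then (1 : L) else 0)).Local v) × ((UnitaryGroup.cmDatum L 1 (Matrix.of fun i j : Fin 1 => if i.val + j.val + 1 = 1 then (1 : L) else 0)).Local v)) → ((UnitaryGroup.cmDatum L 2 (Matrix.of fun i j : Fin 2 => if i.val + j.val + 1 = 2 then (1 : L) else 0)).Local v)) (νH v) = ν₂ →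
        m₂.IsCanonical (fun γ => IsRegularElt (γ.val : GL (Fin 2) (UnitaryGroup.LocalRing L v))) ν₂ →
        ∀ (f₂ : ((UnitaryGroup.cmDatum L 2 (Matrix.of fun i j : Fin 2 => if i.val + j.val + 1 = 2 then (1 : L) else 0)).Local v) → ℂ) (r : ℝ), IsLocSmooth f₂ →
        (∀ γ : ((UnitaryGroup.cmDatum L 2 (Matrix.of fun i j : Fin 2 => if i.val + j.val + 1 = 2 then (1 : L) else 0)).Local v), IsRegularElt (γ.val : GL (Fin 2) (UnitaryGroup.LocalRing L v)) → CompactSpace (Subgroup.centralizer ({γ} : Set ((UnitaryGroup.cmDatum L 2 (Matrix.of fun i j : Fin 2 => if i.val + j.val + 1 = 2 then (1 : L) else 0)).Local v))) →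
            classOrbitalIntegral m₂ f₂ (ConjClasses.mk γ) = 1) →
        (∀ γ : ((UnitaryGroup.cmDatum L 2 (Matrix.of fun i j : Fin 2 => if i.val + j.val + 1 = 2 then (1 : L) else 0)).Local v), IsRegularElt (γ.val : GL (Fin 2) (UnitaryGroup.LocalRing L v)) → ¬ CompactSpace (Subgroup.centralizer ({γ} : Set ((UnitaryGroup.cmDatum L 2 (Matrix.of fun i j : Fin 2 => if i.val + j.val + 1 = 2 then (1 : L) else 0)).Local v))) →
            classOrbitalIntegral m₂ f₂ (ConjClasses.mk γ) = 0) →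
        (∀ (z : ((UnitaryGroup.cmDatum L 2 (Matrix.of fun i j : Fin 2 => if i.val + j.val + 1 = 2 then (1 : L) else 0)).Local v)) (b : UnitaryGroup.LocalRing L v),
            ((z.val : GL (Fin 2) (UnitaryGroup.LocalRing L v)).val : Matrix (Fin 2) (Fin 2) (UnitaryGroup.LocalRing L v)) = b • (1 : Matrix (Fin 2) (Fin 2) (UnitaryGroup.LocalRing L v)) →
            f₂ z = -(r : ℂ)) →
        ∃ (ε' : ((UnitaryGroup.cmDatum L 3 H').Local v)),
          (ε'.val.val : Matrix (Fin 3) (Fin 3) (UnitaryGroup.LocalRing L v)) * P'.val =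
            P'.val * UnitaryGroup.finSum 2 1 (a • (1 : Matrix (Fin 2) (Fin 2) (UnitaryGroup.LocalRing L v))) (εH.2.val.val : Matrix (Fin 1) (Fin 1) (UnitaryGroup.LocalRing L v)) ∧
          IsLocalNormPair L H' v εH ε' ∧
          ∃ V ∈ 𝓝 εH, ∃ φH : ((UnitaryGroup.cmDatum L 2 (Matrix.of fun i j : Fin 2 => if i.val + j.val + 1 = 2 then (1 : L) else 0)).Local v × (UnitaryGroup.cmDatum L 1 (Matrix.of fun i j : Fin 1 => if i.val + j.val + 1 = 1 then (1 : L) else 0)).Local v) → ℂ, IsLocSmooth φH ∧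
            (∀ γH ∈ V, IsLocalGRegular L v γH →
              stableOrbitalIntegralRel (IsLocalStablyConjH L v) mH φH γH =
                ∑ᶠ c : ConjClasses ((UnitaryGroup.cmDatum L 3 H').Local v), ((finExplicitCollection L H' μ (finExplicitDelta_conj_left_all L H' μ) (finExplicitDelta_conj_right_all L H' μ)) v).Δ γH (Quotient.out c) *
                  classOrbitalIntegral mG φ c) ∧
            ∀ (νM : Measure ↥(Subgroup.centralizer ({ε} : Set ((UnitaryGroup.cmDatum L 3 H').Local v)))) [νM.IsHaarMeasure] [νM.IsInvInvariant],
              νM = Measure.map (⇑θ) (νH v) →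
              φH εH =
                finExplicitDelta L v H' εH μ ε *
                    orbitalIntegral ε φ (quotientMeasure (Subgroup.centralizer ({ε} : Set ((UnitaryGroup.cmDatum L 3 H').Local v))) νM
                      (isClosed_coe_centralizer_singleton ε) (νG v)) +
                  finExplicitDelta L v H' εH μ ε' * (∫ y, φ (y * ε' * y⁻¹) ∂(νG v)) * (-(r : ℂ)) := by
  intro L _ _ _ H' μ _ _ _ _ νH νG _ _ _ _ hμu hμω hherm hanis v hv _iH _bH _iG _bG mH mG hmH hmG φ hφ εH a ha hu ε y θ hθε hθ W hW G₁ G₁' G₂ G₂' P'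
    hPW hP' hnn hεO _iU₂ _bU₂ _iZ₂ _bZ₂ ν₂ _ _ m₂ hν₂ hm₂ f₂ r hf₂ hf1 hf0 hfval
  classical
  -- (1) the compact-side package WITH VALUES (★ rung 5): `C′ = Z(ε′)`, the framed second class `ε′`, descent value, named `Δ‴` constant, count
  obtain ⟨C', iGrp, iTop, iTG, iCpt, iLC, iSC, iT2, iMeas, iBor, iQM, iQB, ν', iHaar, iRI, P'', m', hm', εC, ε', hε'P, hmatch, hcentral, hν'ne, hD', hΔ', hcnt⟩ :=
    exists_compactSidePackage_of_badFrame_withValues L H' μ νH νG hμu hμω hherm hanis v hv mH mG hmH hmG φ hφ εH a ha hu ε y θ hθε hθ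
      W hW G₁ G₁' G₂ G₂' P' hPW hP' hnn
  -- (2) the place above `v`, `det H′ ≠ 0`, the dock read as `y ι(ε_H) y⁻¹ = ε`
  obtain ⟨w⟩ := PlacesOver.nonempty L v
  have hw : IsCMField.complexConj L • w.1 = w.1 := smul_eq_of_subsingleton_placesOver L hv w
  have hdet' : H'.det ≠ 0 := by
    intro hdet
    obtain ⟨x, hx, hHx⟩ := Matrix.exists_mulVec_eq_zero_iff.mpr hdet
    exact hx (hanis x (by rw [Literature.AlgebraicGeometry.ShimuraVarieties.hermForm, hHx, dotProduct_zero]))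
  have hy : y * ((endoEmbLocal L v εH).val : GL (Fin 3) (UnitaryGroup.LocalRing L v)) * y⁻¹ = ε.val := by
    rw [← hθ εH, hθε]
  -- (3) the transported Haar measure `θ_* ν_H` on `Z(ε)`
  have hMc : IsClosed (((Subgroup.centralizer ({ε} : Set ((UnitaryGroup.cmDatum L 3 H').Local v))) : Subgroup ((UnitaryGroup.cmDatum L 3 H').Local v)) : Set ((UnitaryGroup.cmDatum L 3 H').Local v)) := isClosed_coe_centralizer_singleton ε
  haveI : LocallyCompactSpace ↥(Subgroup.centralizer ({ε} : Set ((UnitaryGroup.cmDatum L 3 H').Local v))) := hMc.isClosedEmbedding_subtypeVal.locallyCompactSpace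
  haveI hM1 : (Measure.map (⇑θ) (νH v)).IsHaarMeasure := MulEquiv.isHaarMeasure_map (νH v) θ.toMulEquiv θ.continuous θ.symm.continuous
  haveI hM2 : (Measure.map (⇑θ) (νH v)).IsMulRightInvariant :=
    isMulRightInvariant_map_mulEquiv_of_isMulRightInvariant θ.toMulEquiv θ.continuous.measurable (νH v)
  haveI hM3 : (Measure.map (⇑θ) (νH v)).IsInvInvariant :=
    isInvInvariant_of_isMulRightInvariant_of_isClosed (Subgroup.centralizer ({ε} : Set ((UnitaryGroup.cmDatum L 3 H').Local v))) hMc (Measure.map (⇑θ) (νH v))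
  -- (4) the compact side WITH VALUE for the BOUND datum `(ν₂, m₂, f₂, r)` (★ rung 3♭, this seat)
  have hI' := exists_nhds_finsum_side_eq_stableOrbitalIntegralRel_and_apply_centre_of_compact_dock_of_EP L H' v hv μ
    (finExplicitDelta_conj_left_all L H' μ) (finExplicitDelta_conj_right_all L H' μ) (νH v) hmH εH a ha
    (fun γH g => ∃ B : Matrix (Fin 2) (Fin 2) (UnitaryGroup.LocalRing L v),
      (g.val.val : Matrix (Fin 3) (Fin 3) (UnitaryGroup.LocalRing L v)) * P'.val = P'.val * UnitaryGroup.finSum 2 1 B (γH.2.val.val : Matrix (Fin 1) (Fin 1) (UnitaryGroup.LocalRing L v)))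
    C' ν' P'' hm' εC hcentral (fun ψ => (((ν'.real Set.univ)⁻¹ : ℝ) : ℂ) * ∫ y, ψ (y * ε' * y⁻¹) ∂(νG v)) hD' (finExplicitDelta L v H' εH μ ε') hΔ' hcnt
    ν₂ hν₂ hm₂ hf₂ hf1 hf0 r hfval
  -- (5) the junction WITH VALUE (★ rung 1) over the descent WITH VALUE (★ J1)
  obtain ⟨V, hV, φH, hφH, hid, hval⟩ := exists_nhds_stableOrbitalIntegralRel_eq_and_apply_centre_of_central_singular_inv L H' v hherm hdet' μ
    (finExplicitDelta_conj_left_all L H' μ) (finExplicitDelta_conj_right_all L H' μ) (νH v) hmH εH ε y θ hθ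
    (fun γH g => ∃ B : Matrix (Fin 2) (Fin 2) (UnitaryGroup.LocalRing L v),
      (g.val.val : Matrix (Fin 3) (Fin 3) (UnitaryGroup.LocalRing L v)) * P'.val = P'.val * UnitaryGroup.finSum 2 1 B (γH.2.val.val : Matrix (Fin 1) (Fin 1) (UnitaryGroup.LocalRing L v)))
    (exists_nhds_stablySaturated_sep_dock w hw εH a ha hu ε y θ hy hθ)
    ⟨univ, univ_mem, fun γH _ hreg γ' hm => side_of_dock L H' v w hw hherm hdet' εH a ha θ hθ hW hy hPW hP' hnn γH hreg γ' hm⟩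
    ⟨univ, univ_mem, fun γH _ hreg γ' h₁ h₂ => disj_of_dock L H' v θ hθ hW hPW hP' hnn γH hreg γ' h₁ h₂⟩
    (fun ψ => orbitalIntegral ε ψ (quotientMeasure (Subgroup.centralizer ({ε} : Set ((UnitaryGroup.cmDatum L 3 H').Local v))) (Measure.map (⇑θ) (νH v))
      (isClosed_coe_centralizer_singleton ε) (νG v)))
    (fun ψ => finExplicitDelta L v H' εH μ ε' * ((((ν'.real Set.univ : ℝ)) : ℂ) * ((((ν'.real Set.univ)⁻¹ : ℝ) : ℂ) * ∫ y, ψ (y * ε' * y⁻¹) ∂(νG v))) * (-(r : ℂ)))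
    (fun ψ hψ => by
      obtain ⟨B, hB, hsat, ψε, hψε, hvalε, hdesc⟩ :=
        exists_nhds_classOrbitalIntegral_dock_eq_and_apply_centre L H' v hherm hdet' w hw (νH v) (νG v) hmH hmG εH a ha hu ε y θ hθε hθ hεO ψ hψ
      exact ⟨B, hB, hsat, ψε, hψε, hdesc, hvalε _ rfl⟩)
    (exists_nhds_finExplicitDelta_dock_eq w hw μ εH a ha hu ε y θ hy hθ)
    hI' φ hφ
  -- (6) the value at the centre
  refine ⟨ε', hε'P, hmatch, V, hV, φH, hφH, hid, ?_⟩
  have hc : (ν'.real Set.univ : ℝ) ≠ 0 := fun h => hν'ne (by rw [h, Complex.ofReal_zero])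
  have hcI : (((ν'.real Set.univ : ℝ)) : ℂ) * ((((ν'.real Set.univ)⁻¹ : ℝ) : ℂ) * ∫ y, φ (y * ε' * y⁻¹) ∂(νG v)) = ∫ y, φ (y * ε' * y⁻¹) ∂(νG v) := by
    rw [← mul_assoc, ← Complex.ofReal_mul, mul_inv_cancel₀ hc, Complex.ofReal_one, one_mul]
  intro νM _ _ hνM
  subst hνM
  rw [hval, hcI]

end Summit.HodgeConjecture.HodgeConjecture.Cruxes.H413.K2E3SingularTransferDressValueAtCentreOfEP

end
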